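import Summits.KontsevichZagierPeriods.KontsevichZagierPeriods.Theorems.XMapKernel.Negative.Core
import Summits.KontsevichZagierPeriods.KontsevichZagierPeriods.Theorems.XMapPeriodTransfer.Negative.LemniscateReps
import Summits.KontsevichZagierPeriods.KontsevichZagierPeriods.Theorems.RealEllipticSectorKernel.Negative.Lemniscatic

/-!
# `XMapKernel` (stmt-KontsevichZagierPeriods-10663), negative side: the Landen relator — a non-zero x-map period relator

Non-vacuity of the fifth generating set of the crux `XMapKernel` (route `IsogenyCertificates`):
the relator set `xMapRel` (`Negative/Core.lean`) contains a NON-ZERO element, the Landen/Gauss pair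
`[{x³ − x > 0}, 1/√(x³ − x)] − [{X³ + 4X > 0}, 2/√(X³ + 4X)]` joined by the 2-isogeny datum
`(f, g, c) = (X² − 1, X, 1)` from `y² = x³ − x` to `Y² = X³ + 4X` [Silverman AEC III.4.5]. The
load-bearing input is the VALUE IDENTITY (Landen's transformation in the lemniscatic case)
`∫_{x³−x>0} dx/√(x³−x) = ∫₀^∞ 2 dX/√(X³+4X) = Γ(1/4)²/√(2π)`, proved here by real analysis only:
the substitution `X = x − 1/x` maps `(1, ∞)` bijectively onto `(0, ∞)` with
`X³ + 4X = (x³ − x)·((x²+1)/x²)²`, so `dX/√(X³+4X) = dx/√(x³−x)`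
(`MeasureTheory.integral_image_eq_integral_abs_deriv_smul`); the sheet `(1,∞)` has value
`ϖ = Γ(1/4)²/(2√(2π))` (tree: `Literature.Analysis.SpecialFunctions.integral_Ioi_one_inv_sqrt_cube_sub_self`)
and the sheet `(−1,0)` the same value (sibling file `RealEllipticSectorKernel/Negative/Lemniscatic.lean`,
reflection + inversion). This is also the value side of the support item `LemniscateTwoIsogeny`
(stmt-5382) and the calibration pair of `XMapPeriodTransfer` (stmt-10665), made available to provers.

Sources: M. Kontsevich, D. Zagier, *Periods* (2001), §1.2 rule 2); J. H. Silverman, *The Arithmetic of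
Elliptic Curves* (2009), III.4.5; H. McKean, V. Moll, *Elliptic Curves* (1999), pp. 59–60 (Landen);
Yu. V. Nesterenko, P. Philippon (eds.), LNM 1752 (2001), Ch. 1 §3 (the lemniscatic integral). -/

noncomputable section

namespace Summit.KontsevichZagierPeriods.XMapKernel.Negative

open MeasureTheory Set
open Literature.NumberTheory.Transcendental
open Summit.KontsevichZagierPeriods.IsogenyCertificates.XMapPeriodTransferValue
  (cube_add_four_mul_pos_iff cube_sub_self_pos_iff integrableOn_inv_sqrt_cube_sub_self
   integrableOn_inv_sqrt_cube_add_four_mul exists_rep_lemniscate exists_rep_four)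
open Summit.KontsevichZagierPeriods.RealEllipticSectorKernel.CM66 (lemHalf gI integral_gI_Ioo_neg lemHalf_pos)

/-! ### The half lemniscate period `ϖ` and the two sheets of `{x³ − x > 0}` -/

/-- `ϖ = Γ(1/4)²/(2√(2π)) = 2.62205…`, half the real period of `y² = x³ − x`. [folklore] -/
def halfLem : ℝ := Real.Gamma (1 / 4) ^ 2 / (2 * Real.sqrt (2 * Real.pi))

/-- `ϖ = 2 · (Γ(1/4)²/(4√(2π)))`. [folklore] -/
theorem halfLem_eq_two_mul_lemHalf : halfLem = 2 * lemHalf := by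
  unfold halfLem lemHalf
  ring

/-- `0 < ϖ`. [folklore] -/
theorem halfLem_pos : 0 < halfLem := by
  rw [halfLem_eq_two_mul_lemHalf]
  exact mul_pos two_pos lemHalf_pos

/-- `∫_{(1,∞)} dx/√(x³ − x) = ϖ` (tree: the lemniscatic period integral).
[cite: NesterenkoPhilippon2001, Ch. 1 §3 Remark ii] -/
theorem integral_Ioi_one : ∫ x in Ioi (1 : ℝ), 1 / Real.sqrt (x ^ 3 - x) = halfLem := by
  simp only [one_div]
  exact Literature.Analysis.SpecialFunctions.integral_Ioi_one_inv_sqrt_cube_sub_self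

/-- `1/√(x³ − x) = 2/√(4x³ − 4x)` (no sign condition: both sides vanish where `x³ − x ≤ 0`).
[folklore] -/
theorem one_div_sqrt_eq_two_mul_gI (x : ℝ) : 1 / Real.sqrt (x ^ 3 - x) = 2 * gI x := by
  unfold gI
  rw [show 4 * x ^ 3 - 4 * x = 4 * (x ^ 3 - x) by ring, Real.sqrt_mul (by norm_num : (0 : ℝ) ≤ 4),
    show Real.sqrt 4 = 2 by rw [show (4 : ℝ) = 2 ^ 2 by norm_num, Real.sqrt_sq (by norm_num)],
    mul_inv, ← mul_assoc]
  norm_num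

/-- `∫_{(−1,0)} dx/√(x³ − x) = ϖ` (sibling: reflection `x ↦ −x` and inversion `x ↦ 1/x` carry
the bounded sheet onto `(1,∞)`). [folklore] -/
theorem integral_Ioo_neg_one_zero : ∫ x in Ioo (-1 : ℝ) 0, 1 / Real.sqrt (x ^ 3 - x) = halfLem := by
  simp_rw [one_div_sqrt_eq_two_mul_gI]
  rw [integral_const_mul, integral_gI_Ioo_neg, halfLem_eq_two_mul_lemHalf]

/-! ### Landen's substitution `X = x − 1/x` -/

/-- The x-map `R = f/g = (x² − 1)/x = x − 1/x` of the 2-isogeny `y² = x³ − x → Y² = X³ + 4X`.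
[folklore] -/
def landen (x : ℝ) : ℝ := x - x⁻¹

/-- `R′(x) = 1 + 1/x²`. [folklore] -/
theorem hasDerivAt_landen {x : ℝ} (hx : x ≠ 0) : HasDerivAt landen (1 + (x ^ 2)⁻¹) x := by
  have h : HasDerivAt (fun y : ℝ => y - y⁻¹) (1 - -(x ^ 2)⁻¹) x :=
    (hasDerivAt_id' x).sub (hasDerivAt_inv hx)
  have hfun : landen = fun y : ℝ => y - y⁻¹ := rfl
  rw [hfun]
  exact h.congr_deriv (by ring)

/-- `R` is strictly increasing on `(0, ∞)`. [folklore] -/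
theorem landen_strictMonoOn : StrictMonoOn landen (Ioi (0 : ℝ)) := by
  intro a ha b hb hab
  unfold landen
  have : b⁻¹ < a⁻¹ := (inv_lt_inv₀ hb ha).2 hab
  linarith

/-- `R` is injective on `(1, ∞)`. [folklore] -/
theorem landen_injOn : InjOn landen (Ioi (1 : ℝ)) :=
  (landen_strictMonoOn.mono (Ioi_subset_Ioi zero_le_one)).injOn

/-- `R` maps `(1, ∞)` ONTO `(0, ∞)` (inverse branch `x = (X + √(X² + 4))/2`). [folklore] -/
theorem landen_image : landen '' Ioi (1 : ℝ) = Ioi 0 := by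
  ext X
  simp only [mem_image, mem_Ioi]
  constructor
  · rintro ⟨x, hx, rfl⟩
    unfold landen
    have : x⁻¹ < 1 := inv_lt_one_of_one_lt₀ hx
    linarith
  · intro hX
    set s := Real.sqrt (X ^ 2 + 4) with hs
    have hs2 : s ^ 2 = X ^ 2 + 4 := Real.sq_sqrt (by positivity)
    have hspos : 0 < s := Real.sqrt_pos.2 (by positivity)
    have hs_gt : 2 - X < s := by
      by_cases h2 : X < 2
      · have h2X : 0 ≤ 2 - X := by linarith
        nlinarith [hs2, sq_nonneg (2 - X), sq_nonneg (s - (2 - X))]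
      · linarith
    refine ⟨(X + s) / 2, by linarith, ?_⟩
    unfold landen
    have hne : X + s ≠ 0 := by linarith
    field_simp
    nlinarith [hs2]

/-- **The x-map identity of the datum `(X² − 1, X, 1)`** on the real locus:
`R³ + 4R = (x³ − x)·R′²`, `R′ = (x² + 1)/x²`. [cite: SilvermanAEC2009, III.4.5] -/
theorem landen_cubic {x : ℝ} (hx : x ≠ 0) :
    landen x ^ 3 + 4 * landen x = (x ^ 3 - x) * ((x ^ 2 + 1) / x ^ 2) ^ 2 := by
  unfold landen
  field_simp
  ring

/-- Rule 2)'s integrand identity on the sheet `(1, ∞)`: `|R′| · 2/√(R³ + 4R) = 2/√(x³ − x)`.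
[cite: KontsevichZagier2001, §1.2 rule 2)] -/
theorem landen_weight {x : ℝ} (hx : 1 < x) :
    |1 + (x ^ 2)⁻¹| • (2 / Real.sqrt (landen x ^ 3 + 4 * landen x)) = 2 / Real.sqrt (x ^ 3 - x) := by
  have hx0 : 0 < x := by linarith
  have hq : 0 < (x ^ 2 + 1) / x ^ 2 := by positivity
  have hP : 0 < x ^ 3 - x := by nlinarith
  have habs : |1 + (x ^ 2)⁻¹| = (x ^ 2 + 1) / x ^ 2 := by
    rw [abs_of_pos (by positivity)]
    field_simp
  rw [habs, smul_eq_mul, landen_cubic hx0.ne', Real.sqrt_mul hP.le, Real.sqrt_sq hq.le]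
  have hs : 0 < Real.sqrt (x ^ 3 - x) := Real.sqrt_pos.2 hP
  field_simp

/-- **Landen's transformation, value form**: `∫₀^∞ 2 dX/√(X³ + 4X) = 2ϖ`.
[cite: KontsevichZagier2001, §1.2 rule 2)] -/
theorem integral_Ioi_zero_landen : ∫ X in Ioi (0 : ℝ), 2 / Real.sqrt (X ^ 3 + 4 * X) = 2 * halfLem := by
  have key := integral_image_eq_integral_abs_deriv_smul (s := Ioi (1 : ℝ)) (f := landen)
    (f' := fun x => 1 + (x ^ 2)⁻¹) measurableSet_Ioi
    (fun x hx => (hasDerivAt_landen (by simp only [mem_Ioi] at hx; exact ne_of_gt (by linarith))).hasDerivWithinAt)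
    landen_injOn (fun X => 2 / Real.sqrt (X ^ 3 + 4 * X))
  rw [landen_image] at key
  rw [key, setIntegral_congr_fun measurableSet_Ioi (fun x hx => landen_weight hx)]
  simp_rw [div_eq_mul_one_div (2 : ℝ)]
  rw [integral_const_mul, integral_Ioi_one]

/-- **The total real period of `y² = x³ − x`**: `∫_{(−1,0) ∪ (1,∞)} dx/√(x³ − x) = 2ϖ = Γ(1/4)²/√(2π)`.
[cite: NesterenkoPhilippon2001, Ch. 1 §3 Remark ii] -/
theorem integral_sheets : ∫ x in Ioo (-1 : ℝ) 0 ∪ Ioi 1, 1 / Real.sqrt (x ^ 3 - x) = 2 * halfLem := by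
  have hdisj : Disjoint (Ioo (-1 : ℝ) 0) (Ioi 1) :=
    Set.disjoint_left.2 fun t h1 h2 => by
      simp only [mem_Ioo] at h1
      simp only [mem_Ioi] at h2
      linarith
  rw [setIntegral_union hdisj measurableSet_Ioi
      (integrableOn_inv_sqrt_cube_sub_self.mono_set subset_union_left)
      (integrableOn_inv_sqrt_cube_sub_self.mono_set subset_union_right),
    integral_Ioo_neg_one_zero, integral_Ioi_one]
  ring

/-! ### The two representations of the crux have EQUAL values -/

/-- Value of `r = [{x³ − x > 0}, 1/√(x³ − x)]` (any presentation): `2ϖ`. [folklore] -/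
theorem value_rep_lemniscate (r : KZ.IntegralRep 1)
    (hd : r.domain = {x : Fin 1 → ℝ | 0 < x 0 ^ 3 + ((-1 : ℤ) : ℝ) * x 0 + ((0 : ℤ) : ℝ)})
    (hi : EqOn r.integrand (fun x => ((1 : ℚ) : ℝ) / Real.sqrt (x 0 ^ 3 + ((-1 : ℤ) : ℝ) * x 0 + ((0 : ℤ) : ℝ))) r.domain) :
    r.value = 2 * halfLem := by
  have hmp := MeasureTheory.volume_preserving_funUnique (Fin 1) ℝ
  have hset : {x : Fin 1 → ℝ | 0 < x 0 ^ 3 + ((-1 : ℤ) : ℝ) * x 0 + ((0 : ℤ) : ℝ)} =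
      (MeasurableEquiv.funUnique (Fin 1) ℝ) ⁻¹' (Ioo (-1 : ℝ) 0 ∪ Ioi 1) := by
    ext x
    rw [mem_preimage, ← cube_sub_self_pos_iff]
    simp [MeasurableEquiv.funUnique, Fin.default_eq_zero, sub_eq_add_neg]
  have hmeas : MeasurableSet ((MeasurableEquiv.funUnique (Fin 1) ℝ) ⁻¹' (Ioo (-1 : ℝ) 0 ∪ Ioi 1)) :=
    (measurableSet_Ioo.union measurableSet_Ioi).preimage (MeasurableEquiv.measurable _)
  rw [KZ.IntegralRep.value, setIntegral_congr_fun (KZ.IntegralRep.measurableSet_domain_holds r) hi, hd,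
    hset]
  have key := hmp.setIntegral_preimage_emb (MeasurableEquiv.measurableEmbedding _)
    (fun t : ℝ => 1 / Real.sqrt (t ^ 3 - t)) (Ioo (-1 : ℝ) 0 ∪ Ioi 1)
  rw [integral_sheets] at key
  refine Eq.trans (setIntegral_congr_fun hmeas fun x _ => ?_) key
  simp [MeasurableEquiv.funUnique, Fin.default_eq_zero, sub_eq_add_neg]

/-- Value of `r′ = [{X³ + 4X > 0}, 2/√(X³ + 4X)]` (any presentation): `2ϖ`. [folklore] -/
theorem value_rep_four (r' : KZ.IntegralRep 1)
    (hd : r'.domain = {x : Fin 1 → ℝ | 0 < x 0 ^ 3 + ((4 : ℤ) : ℝ) * x 0 + ((0 : ℤ) : ℝ)})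
    (hi : EqOn r'.integrand (fun x => ((2 : ℚ) : ℝ) / Real.sqrt (x 0 ^ 3 + ((4 : ℤ) : ℝ) * x 0 + ((0 : ℤ) : ℝ))) r'.domain) :
    r'.value = 2 * halfLem := by
  have hmp := MeasureTheory.volume_preserving_funUnique (Fin 1) ℝ
  have hset : {x : Fin 1 → ℝ | 0 < x 0 ^ 3 + ((4 : ℤ) : ℝ) * x 0 + ((0 : ℤ) : ℝ)} =
      (MeasurableEquiv.funUnique (Fin 1) ℝ) ⁻¹' Ioi 0 := by
    ext x
    rw [mem_preimage, mem_Ioi, ← cube_add_four_mul_pos_iff]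
    simp [MeasurableEquiv.funUnique, Fin.default_eq_zero]
  have hmeas : MeasurableSet ((MeasurableEquiv.funUnique (Fin 1) ℝ) ⁻¹' Ioi (0 : ℝ)) :=
    measurableSet_Ioi.preimage (MeasurableEquiv.measurable _)
  rw [KZ.IntegralRep.value, setIntegral_congr_fun (KZ.IntegralRep.measurableSet_domain_holds r') hi, hd,
    hset]
  have key := hmp.setIntegral_preimage_emb (MeasurableEquiv.measurableEmbedding _)
    (fun t : ℝ => 2 / Real.sqrt (t ^ 3 + 4 * t)) (Ioi (0 : ℝ))
  rw [integral_Ioi_zero_landen] at key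
  refine Eq.trans (setIntegral_congr_fun hmeas fun x _ => ?_) key
  simp [MeasurableEquiv.funUnique, Fin.default_eq_zero]

/-- **Value equality of the Landen pair** (the hypothesis `r.value = r′.value` of the crux, discharged):
`∫_{x³−x>0} dx/√(x³−x) = ∫_{X³+4X>0} 2 dX/√(X³+4X)`. [cite: KontsevichZagier2001, §1.2 rule 2)] -/
theorem value_lemniscate_eq_value_four (r r' : KZ.IntegralRep 1)
    (hd : r.domain = {x : Fin 1 → ℝ | 0 < x 0 ^ 3 + ((-1 : ℤ) : ℝ) * x 0 + ((0 : ℤ) : ℝ)})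
    (hi : EqOn r.integrand (fun x => ((1 : ℚ) : ℝ) / Real.sqrt (x 0 ^ 3 + ((-1 : ℤ) : ℝ) * x 0 + ((0 : ℤ) : ℝ))) r.domain)
    (hd' : r'.domain = {x : Fin 1 → ℝ | 0 < x 0 ^ 3 + ((4 : ℤ) : ℝ) * x 0 + ((0 : ℤ) : ℝ)})
    (hi' : EqOn r'.integrand (fun x => ((2 : ℚ) : ℝ) / Real.sqrt (x 0 ^ 3 + ((4 : ℤ) : ℝ) * x 0 + ((0 : ℤ) : ℝ))) r'.domain) :
    r.value = r'.value := by
  rw [value_rep_lemniscate r hd hi, value_rep_four r' hd' hi']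

/-! ### The 2-isogeny datum `(X² − 1, X, 1)` and the Landen relator -/

/-- Wronskian of the datum: `W = f′g − fg′ = X² + 1`. [cite: SilvermanAEC2009, III.4.5] -/
theorem wronskian_landen :
    Polynomial.derivative (Polynomial.X ^ 2 - 1 : Polynomial ℚ) * Polynomial.X -
      (Polynomial.X ^ 2 - 1) * Polynomial.derivative Polynomial.X = Polynomial.X ^ 2 + 1 := by
  simp only [Polynomial.derivative_sub, Polynomial.derivative_X_pow, Polynomial.derivative_one,
    Polynomial.derivative_X, Nat.cast_ofNat, map_ofNat]
  norm_num
  ring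

/-- `W ≠ 0`. [folklore] -/
theorem wronskian_landen_ne_zero :
    Polynomial.derivative (Polynomial.X ^ 2 - 1 : Polynomial ℚ) * Polynomial.X -
      (Polynomial.X ^ 2 - 1) * Polynomial.derivative Polynomial.X ≠ 0 := by
  rw [wronskian_landen]
  intro h
  have := congrArg (Polynomial.eval 0) h
  simp at this

/-- **The datum identity** `c²·g·(f³ + A′fg² + B′g³) = (X³ + AX + B)·W²` for
`(A,B,A′,B′) = (−1,0,4,0)`, `(f,g,c) = (X²−1, X, 1)`: both sides are `X(X²−1)(X²+1)²`.
[cite: SilvermanAEC2009, III.4.5] -/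
theorem datum_landen :
    Polynomial.C ((1 : ℚ) ^ 2) * Polynomial.X *
        ((Polynomial.X ^ 2 - 1) ^ 3 + Polynomial.C (((4 : ℤ) : ℚ)) * (Polynomial.X ^ 2 - 1) * Polynomial.X ^ 2 +
          Polynomial.C (((0 : ℤ) : ℚ)) * Polynomial.X ^ 3) =
      (Polynomial.X ^ 3 + Polynomial.C (((-1 : ℤ) : ℚ)) * Polynomial.X + Polynomial.C (((0 : ℤ) : ℚ))) *
        (Polynomial.derivative (Polynomial.X ^ 2 - 1 : Polynomial ℚ) * Polynomial.X -
          (Polynomial.X ^ 2 - 1) * Polynomial.derivative Polynomial.X) ^ 2 := by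
  rw [wronskian_landen]
  simp only [one_pow, map_one, one_mul, Int.cast_ofNat, Int.cast_zero, map_zero, zero_mul, add_zero,
    Int.cast_neg, Int.cast_one, map_neg, map_one]
  have h4 : (Polynomial.C (4 : ℚ)) = 4 := rfl
  rw [h4]
  ring

/-! ### The Landen relator is not a scissors congruence (restricted evaluation over `{x < 0}`) -/

/-- The window "all coordinates negative" (in dimension `1`: the half-line `x < 0`), one per
dimension, for `KZ.restrictedEval`. [folklore] -/
def negWindow (n : ℕ) : Set (Fin n → ℝ) := {x | ∀ i, x i < 0}

/-- The windows are measurable. [folklore] -/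
theorem measurableSet_negWindow (n : ℕ) : MeasurableSet (negWindow n) := by
  have h : negWindow n = ⋂ i, {x : Fin n → ℝ | x i < 0} := by
    ext x
    simp [negWindow]
  rw [h]
  exact MeasurableSet.iInter fun i => measurableSet_lt (measurable_pi_apply i) measurable_const

/-- `r′ = [{X³+4X>0}, …]` does not meet the window: restricted value `0`. [folklore] -/
theorem setIntegral_negWindow_rep_four (r' : KZ.IntegralRep 1)
    (hd' : r'.domain = {x : Fin 1 → ℝ | 0 < x 0 ^ 3 + ((4 : ℤ) : ℝ) * x 0 + ((0 : ℤ) : ℝ)}) :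
    ∫ x in r'.domain ∩ negWindow 1, r'.integrand x = 0 := by
  have h : r'.domain ∩ negWindow 1 = ∅ := by
    ext x
    simp only [hd', negWindow, mem_inter_iff, mem_setOf_eq, mem_empty_iff_false, iff_false, not_and,
      Fin.forall_fin_one]
    intro hx hneg
    have hx' : 0 < x 0 ^ 3 + 4 * x 0 := by push_cast at hx; linarith
    have := (cube_add_four_mul_pos_iff (x 0)).1 hx'
    linarith
  rw [h, Measure.restrict_empty, integral_zero_measure]

/-- `r = [{x³−x>0}, 1/√(x³−x)]` restricted to the window is the bounded sheet `(−1,0)`: restricted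
value `ϖ`. [folklore] -/
theorem setIntegral_negWindow_rep_lemniscate (r : KZ.IntegralRep 1)
    (hd : r.domain = {x : Fin 1 → ℝ | 0 < x 0 ^ 3 + ((-1 : ℤ) : ℝ) * x 0 + ((0 : ℤ) : ℝ)})
    (hi : EqOn r.integrand (fun x => ((1 : ℚ) : ℝ) / Real.sqrt (x 0 ^ 3 + ((-1 : ℤ) : ℝ) * x 0 + ((0 : ℤ) : ℝ))) r.domain) :
    ∫ x in r.domain ∩ negWindow 1, r.integrand x = halfLem := by
  have hmp := MeasureTheory.volume_preserving_funUnique (Fin 1) ℝ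
  have hset : r.domain ∩ negWindow 1 = (MeasurableEquiv.funUnique (Fin 1) ℝ) ⁻¹' Ioo (-1 : ℝ) 0 := by
    ext x
    simp only [hd, negWindow, mem_inter_iff, mem_setOf_eq, mem_preimage, mem_Ioo, Fin.forall_fin_one]
    simp only [MeasurableEquiv.funUnique]
    constructor
    · rintro ⟨hx, hneg⟩
      have hx' : 0 < x 0 ^ 3 - x 0 := by push_cast at hx; linarith
      rcases (cube_sub_self_pos_iff (x 0)).1 hx' with h | h
      · exact h
      · simp only [mem_Ioi] at h
        linarith
    · rintro ⟨h1, h2⟩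
      have hx' : 0 < x 0 ^ 3 - x 0 := (cube_sub_self_pos_iff (x 0)).2 (Or.inl ⟨h1, h2⟩)
      refine ⟨by push_cast; linarith, h2⟩
  have hmeas : MeasurableSet (r.domain ∩ negWindow 1) :=
    (KZ.IntegralRep.measurableSet_domain_holds r).inter (measurableSet_negWindow 1)
  have hmeas' : MeasurableSet ((MeasurableEquiv.funUnique (Fin 1) ℝ) ⁻¹' Ioo (-1 : ℝ) 0) :=
    measurableSet_Ioo.preimage (MeasurableEquiv.measurable _)
  rw [setIntegral_congr_fun hmeas (hi.mono inter_subset_left), hset]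
  have key := hmp.setIntegral_preimage_emb (MeasurableEquiv.measurableEmbedding _)
    (fun t : ℝ => 1 / Real.sqrt (t ^ 3 - t)) (Ioo (-1 : ℝ) 0)
  rw [integral_Ioo_neg_one_zero] at key
  refine Eq.trans (setIntegral_congr_fun hmeas' fun x _ => ?_) key
  simp [MeasurableEquiv.funUnique, Fin.default_eq_zero, sub_eq_add_neg]

/-- **The Landen relator.** The pair `[{x³−x>0}, 1/√(x³−x)] − [{X³+4X>0}, 2/√(X³+4X)]` with the
2-isogeny datum `(X²−1, X, 1)` from `(A,B) = (−1,0)` to `(A′,B′) = (4,0)` satisfies every conjunct of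
`xMapRel`, value equality included; its restricted evaluation over `{x < 0}` is `ϖ ≠ 0`, so it is NOT
in the additive sub-calculus `closure ((1a) ∪ (1b))` (its derivation needs a rule-2 or rule-3 move —
the planner's chain uses two changes of variables), in particular it is `≠ 0`; and its coefficient sum
is `0` (so `KZ.coeffSum` does not force an additivity move for it).
[cite: SilvermanAEC2009, III.4.5] -/
theorem exists_landen_relator :
    ∃ d ∈ xMapRel, KZ.restrictedEval negWindow d = halfLem ∧ KZ.coeffSum d = 0 ∧
      d ∉ AddSubgroup.closure (KZ.domainAddRel ∪ KZ.integrandAddRel) ∧ d ≠ 0 := by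
  obtain ⟨r, hd, hi⟩ := exists_rep_lemniscate 1
  obtain ⟨r', hd', hi'⟩ := exists_rep_four 2
  have hie : EqOn r.integrand (fun x => ((1 : ℚ) : ℝ) / Real.sqrt (x 0 ^ 3 + ((-1 : ℤ) : ℝ) * x 0 + ((0 : ℤ) : ℝ))) r.domain := by
    rw [hi]; exact fun _ _ => rfl
  have hie' : EqOn r'.integrand (fun x => ((2 : ℚ) : ℝ) / Real.sqrt (x 0 ^ 3 + ((4 : ℤ) : ℝ) * x 0 + ((0 : ℤ) : ℝ))) r'.domain := by
    rw [hi']; exact fun _ _ => rfl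
  have hre : KZ.restrictedEval negWindow (KZ.of r - KZ.of r') = halfLem := by
    rw [map_sub, KZ.restrictedEval_of, KZ.restrictedEval_of, setIntegral_negWindow_rep_lemniscate r hd hie,
      setIntegral_negWindow_rep_four r' hd', sub_zero]
  have hnot : KZ.of r - KZ.of r' ∉ AddSubgroup.closure (KZ.domainAddRel ∪ KZ.integrandAddRel) := fun h => by
    have hk := KZ.closure_add_le_ker_restrictedEval negWindow measurableSet_negWindow h
    rw [AddMonoidHom.mem_ker, hre] at hk
    exact halfLem_pos.ne' hk
  refine ⟨KZ.of r - KZ.of r', ⟨-1, 0, 4, 0, Polynomial.X ^ 2 - 1, Polynomial.X, 1, 1, 2, r, r', by norm_num,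
    by norm_num, wronskian_landen_ne_zero, datum_landen, one_pos, two_pos, hd, hie, hd', hie',
    value_lemniscate_eq_value_four r r' hd hie hd' hie', rfl⟩, hre, by simp, hnot, fun h0 => ?_⟩
  exact hnot (h0 ▸ AddSubgroup.zero_mem _)

/-- **A non-zero x-map period relator exists**: the fifth generating set of the crux is non-trivial
as typed. [folklore] -/
theorem exists_ne_zero_mem_xMapRel : ∃ d ∈ xMapRel, d ≠ 0 := by
  obtain ⟨d, hd, -, -, -, hne⟩ := exists_landen_relator
  exact ⟨d, hd, hne⟩

end Summit.KontsevichZagierPeriods.XMapKernel.Negative
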